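import Mathlib
import Literature.Probability.Percolation.PercolationProofs
import Literature.Probability.LatticeModels.ProdBernoulliClusterLocality
import Summits.CriticalPhenomena.PercolationContinuityZ3.Theorems.PercNearOneGluingAdditiveGluingOneBond
import Summits.CriticalPhenomena.PercolationContinuityZ3.Theorems.PercNearOneGluingAdditiveGluingGoodBase
import Summits.CriticalPhenomena.PercolationContinuityZ3.Theorems.PercNearOneGluingAdditiveGluingLemma5AnyRelay
import HarnessLib

/-! # Crux `PercNearOneGluing.AdditiveGluing` (stmt-CriticalPhenomena-4576), line `subuniform-dead-pocket-maximum` —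
# the inductive step `stub_goodStep` REDUCED to two-block designated goodness (edge interpolation)

Helper file for the crux (skeleton `Cruxes/AdditiveGluing/Lines/subuniform-dead-pocket-maximum.lean`).
Notation: `μ_w = prodBernoulli w`; `τ_w(x) = μ_w(x ↔ b)`; for an observer `o ∉ A ∋ b` and a selection
`sel W ∈ A`, the GOOD left side
`L_w(sel) = μ_w(o ↔ A, o ↮ b) + Σ_{W ∋ o, W ∩ A = ∅} μ_w(C(o) = W) · μ_w((sel W ↔ b in Wᶜ)ᶜ)`;
a relay `a ∈ A` is GOOD for `(w, A, o, b)` if `L_w(sel) ≤ μ_w(a ↮ b)` for every selection (then the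
registered conclusion `L_w(sel) ≤ t` holds for every admissible level `t`, since `1 - t ≤ τ_w(a)`).

**Edge interpolation** (the shape of Kozma–Nitzan's inductive approach, arXiv:2401.12397 §5.3,
transferred from Conjecture 1 to goodness).  Fix a LOW pair `e = s(o, y)` (`y ∉ A`, `y ≠ o`) and let
`w₀ = w[e ↦ 0]`, `w₁ = w[e ↦ 1]`, `p = w e`.
* One-bond decomposition: `μ_w(S) = (1 - p) μ_{w₀}(S) + p μ_{w₁}(S)` for every event `S`
  (`stub_oneBondDecomp_k15`; closed side = `prodBernoulli_map_sdiff_singleton`, open side = the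
  pushforward `insert e` of `μ_w` is `μ_{w₁}`, `goodStepEI_prodBernoulli_map_insert`).
* `L_w(sel)` is AFFINE in `p`: `o` lies in every pocket `W`, so `μ((sel W ↔ b in Wᶜ)ᶜ)` does not see
  `e` (`goodStepEI_real_dead_eq`), and the other factors decompose (`goodStepEI_L_decomp`).
  Hence a relay good for BOTH `w₀` and `w₁` is good for `w` (`goodStepEI_interpolate`).
* `w₀` has one low pair fewer at `o`; iterating down to no low pair at all reaches the landed base
  `stub_goodBase stub_lemma5AnyRelay` (KN Thm 4), whose good relay may be taken to be the
  `τ_{w₀}`-minimiser `a₀` (a relay less reliable than a good one is good).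
* The ONLY missing piece is a common relay: that `a₀` (the minimiser AFTER DELETING `e`) is still
  good AFTER GLUING `e` — hypothesis `hR4` below, "two-block designated goodness": with
  `U = C_{w₀}(o) ∪ C_{w₀}(y)` it reads `μ(b ∈ U) + Σ_{W ∩ A = ∅} μ(U = W) min_A τ_{w₀ − W} ≥ τ_{w₀}(a₀)`,
  i.e. Kozma–Nitzan goodness with the Question-9 relay for an observer that is a sure star of
  degree two.  (Numerics of this session: 0 violations under adversarial exact enumeration,
  n ≤ 8; the symmetric transfer — the `w₁`-minimiser good for `w₀` — is FALSE.)
Consequently `stub_goodStep` follows from `hR4` ALONE (`stub_goodStepOfTwoBlock_k15`): its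
induction hypothesis on the number of positive-degree vertices and its low-neighbour hypothesis are
not used.  No new definitions. -/

namespace Summit.CriticalPhenomena.PercolationContinuityZ3.Theorems

open MeasureTheory Set
open Literature.Probability.LatticeModels (prodBernoulli)
open Literature.Probability.Percolation (BondConfig openConn openConnIn openGraph openCluster
  openGraph_adj DeterminedBy determinedBy_iff)
open scoped BigOperators

noncomputable section
open Classical

variable {n : ℕ}

/-! ### The GOOD functional is affine in the weight of a pair at the observer -/

/-- For a pocket `W ∋ o`, the penalty factor `μ((x ↔ b in Wᶜ)ᶜ)` does not see the pairs at `o`: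
it is unchanged when the weight of `s(o, y)` is replaced by any `c`. [folklore] -/
theorem goodStepEI_real_dead_eq (w : Sym2 (Fin n) → unitInterval) {o : Fin n} (y : Fin n)
    {W : Finset (Fin n)} (hoW : o ∈ W) (c : unitInterval) (x b : Fin n) :
    (prodBernoulli (Function.update w s(o, y) c)).real (openConnIn ((W : Set (Fin n))ᶜ) x b)ᶜ =
      (prodBernoulli w).real (openConnIn ((W : Set (Fin n))ᶜ) x b)ᶜ := by
  refine Literature.Probability.LatticeModels.prodBernoulli_real_eq_of_determinedBy _ _
    (F := ((W : Set (Fin n))ᶜ).sym2) ?_ ?_ (Set.toFinite _).measurableSet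
  · intro i hi
    have hne : i ≠ s(o, y) := by
      rintro rfl
      exact (Set.mk_mem_sym2_iff.1 hi).1 (Finset.mem_coe.2 hoW)
    exact Function.update_of_ne hne _ _
  · have h := Literature.Probability.Percolation.DCT16.determinedBy_openConnIn
      ((W : Set (Fin n))ᶜ) x b (K := ((W : Set (Fin n))ᶜ).sym2) subset_rfl
    rw [determinedBy_iff] at h ⊢
    intro ω ω' hωω'
    simp only [mem_compl_iff]
    exact not_congr (h ω ω' hωω')

/-- **`L_w(sel)` is affine in `w s(o,y)`**: with `w₀ = w[s(o,y) ↦ 0]`, `w₁ = w[s(o,y) ↦ 1]` and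
`p = w s(o,y)`, `L_w(sel) = (1 − p) L_{w₀}(sel) + p L_{w₁}(sel)`. [folklore] -/
theorem goodStepEI_L_decomp (w : Sym2 (Fin n) → unitInterval) (A : Finset (Fin n)) (o y b : Fin n)
    (sel : Finset (Fin n) → Fin n) :
    (prodBernoulli w).real ((⋃ a ∈ A, openConn o a) ∩ (openConn o b)ᶜ)
        + ∑ W ∈ (Finset.univ : Finset (Finset (Fin n))).filter (fun W => o ∈ W ∧ Disjoint W A),
            (prodBernoulli w).real {ω : BondConfig (Fin n) | openCluster ω o = (W : Set (Fin n))}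
              * (prodBernoulli w).real (openConnIn ((W : Set (Fin n))ᶜ) (sel W) b)ᶜ =
      (1 - (w s(o, y) : ℝ)) *
        ((prodBernoulli (Function.update w s(o, y) 0)).real ((⋃ a ∈ A, openConn o a) ∩ (openConn o b)ᶜ)
          + ∑ W ∈ (Finset.univ : Finset (Finset (Fin n))).filter (fun W => o ∈ W ∧ Disjoint W A),
              (prodBernoulli (Function.update w s(o, y) 0)).real
                  {ω : BondConfig (Fin n) | openCluster ω o = (W : Set (Fin n))}
                * (prodBernoulli (Function.update w s(o, y) 0)).real
                    (openConnIn ((W : Set (Fin n))ᶜ) (sel W) b)ᶜ)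
      + (w s(o, y) : ℝ) *
        ((prodBernoulli (Function.update w s(o, y) 1)).real ((⋃ a ∈ A, openConn o a) ∩ (openConn o b)ᶜ)
          + ∑ W ∈ (Finset.univ : Finset (Finset (Fin n))).filter (fun W => o ∈ W ∧ Disjoint W A),
              (prodBernoulli (Function.update w s(o, y) 1)).real
                  {ω : BondConfig (Fin n) | openCluster ω o = (W : Set (Fin n))}
                * (prodBernoulli (Function.update w s(o, y) 1)).real
                    (openConnIn ((W : Set (Fin n))ᶜ) (sel W) b)ᶜ) := by
  have hterm : ∀ W ∈ (Finset.univ : Finset (Finset (Fin n))).filter (fun W => o ∈ W ∧ Disjoint W A),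
      (prodBernoulli w).real {ω : BondConfig (Fin n) | openCluster ω o = (W : Set (Fin n))}
          * (prodBernoulli w).real (openConnIn ((W : Set (Fin n))ᶜ) (sel W) b)ᶜ =
        (1 - (w s(o, y) : ℝ)) *
            ((prodBernoulli (Function.update w s(o, y) 0)).real
                {ω : BondConfig (Fin n) | openCluster ω o = (W : Set (Fin n))}
              * (prodBernoulli (Function.update w s(o, y) 0)).real
                  (openConnIn ((W : Set (Fin n))ᶜ) (sel W) b)ᶜ)
          + (w s(o, y) : ℝ) *
            ((prodBernoulli (Function.update w s(o, y) 1)).real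
                {ω : BondConfig (Fin n) | openCluster ω o = (W : Set (Fin n))}
              * (prodBernoulli (Function.update w s(o, y) 1)).real
                  (openConnIn ((W : Set (Fin n))ᶜ) (sel W) b)ᶜ) := by
    intro W hW
    have hoW : o ∈ W := (Finset.mem_filter.1 hW).2.1
    rw [stub_oneBondDecomp_k15 n w s(o, y) {ω : BondConfig (Fin n) | openCluster ω o = (W : Set (Fin n))},
      goodStepEI_real_dead_eq w y hoW 0, goodStepEI_real_dead_eq w y hoW 1]
    ring
  rw [Finset.sum_congr rfl hterm, Finset.sum_add_distrib, ← Finset.mul_sum, ← Finset.mul_sum,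
    stub_oneBondDecomp_k15 n w s(o, y) ((⋃ a ∈ A, openConn o a) ∩ (openConn o b)ᶜ)]
  ring

/-- **Interpolation**: a relay `a` that is good for `w[s(o,y) ↦ 0]` and for `w[s(o,y) ↦ 1]` is good
for `w`. [folklore] -/
theorem goodStepEI_interpolate (w : Sym2 (Fin n) → unitInterval) (A : Finset (Fin n)) (o y b a : Fin n)
    (sel : Finset (Fin n) → Fin n)
    (h0 : (prodBernoulli (Function.update w s(o, y) 0)).real ((⋃ a ∈ A, openConn o a) ∩ (openConn o b)ᶜ)
          + ∑ W ∈ (Finset.univ : Finset (Finset (Fin n))).filter (fun W => o ∈ W ∧ Disjoint W A),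
              (prodBernoulli (Function.update w s(o, y) 0)).real
                  {ω : BondConfig (Fin n) | openCluster ω o = (W : Set (Fin n))}
                * (prodBernoulli (Function.update w s(o, y) 0)).real
                    (openConnIn ((W : Set (Fin n))ᶜ) (sel W) b)ᶜ
          ≤ (prodBernoulli (Function.update w s(o, y) 0)).real (openConn a b)ᶜ)
    (h1 : (prodBernoulli (Function.update w s(o, y) 1)).real ((⋃ a ∈ A, openConn o a) ∩ (openConn o b)ᶜ)
          + ∑ W ∈ (Finset.univ : Finset (Finset (Fin n))).filter (fun W => o ∈ W ∧ Disjoint W A),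
              (prodBernoulli (Function.update w s(o, y) 1)).real
                  {ω : BondConfig (Fin n) | openCluster ω o = (W : Set (Fin n))}
                * (prodBernoulli (Function.update w s(o, y) 1)).real
                    (openConnIn ((W : Set (Fin n))ᶜ) (sel W) b)ᶜ
          ≤ (prodBernoulli (Function.update w s(o, y) 1)).real (openConn a b)ᶜ) :
    (prodBernoulli w).real ((⋃ a ∈ A, openConn o a) ∩ (openConn o b)ᶜ)
        + ∑ W ∈ (Finset.univ : Finset (Finset (Fin n))).filter (fun W => o ∈ W ∧ Disjoint W A),
            (prodBernoulli w).real {ω : BondConfig (Fin n) | openCluster ω o = (W : Set (Fin n))}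
              * (prodBernoulli w).real (openConnIn ((W : Set (Fin n))ᶜ) (sel W) b)ᶜ
      ≤ (prodBernoulli w).real (openConn a b)ᶜ := by
  rw [goodStepEI_L_decomp w A o y b sel, stub_oneBondDecomp_k15 n w s(o, y) (openConn a b)ᶜ]
  have hp0 : 0 ≤ (w s(o, y) : ℝ) := (w s(o, y)).2.1
  have hp1 : (w s(o, y) : ℝ) ≤ 1 := (w s(o, y)).2.2
  have hq0 : 0 ≤ 1 - (w s(o, y) : ℝ) := by linarith
  exact add_le_add (mul_le_mul_of_nonneg_left h0 hq0) (mul_le_mul_of_nonneg_left h1 hp0)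

/-! ### Designated goodness by induction on the number of low pairs at the observer -/

/-- **A good relay exists**, given two-block designated goodness `hR4` (see the module docstring):
by induction on the number `k` of low pairs at `o` (`z ∉ A`, `z ≠ o`, `w s(o,z) ≠ 0`).  Base
`k = 0`: KN Theorem 4 (`stub_goodBase stub_lemma5AnyRelay`, landed) makes the `τ_w`-minimiser good.
Step: delete a low pair `e = s(o,y)`; the induction hypothesis gives a good relay for `w[e ↦ 0]`,
hence the `τ_{w[e↦0]}`-minimiser `a₀` is good there; `hR4` makes `a₀` good for `w[e ↦ 1]`;
interpolate (`goodStepEI_interpolate`). -/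
theorem goodStepEI_designated
    (hR4 : ∀ (n : ℕ) (w : Sym2 (Fin n) → unitInterval) (A : Finset (Fin n)) (o y b a₀ : Fin n),
      b ∈ A → o ∉ A → y ∉ A → y ≠ o → a₀ ∈ A → w s(o, y) = 1 →
      (∀ a ∈ A, (prodBernoulli (Function.update w s(o, y) 0)).real (openConn a₀ b)
        ≤ (prodBernoulli (Function.update w s(o, y) 0)).real (openConn a b)) →
      ∀ (sel : Finset (Fin n) → Fin n), (∀ W, sel W ∈ A) →
        (prodBernoulli w).real ((⋃ a ∈ A, openConn o a) ∩ (openConn o b)ᶜ)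
          + ∑ W ∈ (Finset.univ : Finset (Finset (Fin n))).filter (fun W => o ∈ W ∧ Disjoint W A),
              (prodBernoulli w).real {ω : BondConfig (Fin n) | openCluster ω o = (W : Set (Fin n))}
                * (prodBernoulli w).real (openConnIn ((W : Set (Fin n))ᶜ) (sel W) b)ᶜ
          ≤ (prodBernoulli w).real (openConn a₀ b)ᶜ) :
    ∀ (k : ℕ) (w : Sym2 (Fin n) → unitInterval) (A : Finset (Fin n)) (o b : Fin n), b ∈ A → o ∉ A →
      (Finset.univ.filter (fun z : Fin n => z ∉ A ∧ z ≠ o ∧ (w s(o, z) : ℝ) ≠ 0)).card = k →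
      ∃ a ∈ A, ∀ (sel : Finset (Fin n) → Fin n), (∀ W, sel W ∈ A) →
        (prodBernoulli w).real ((⋃ a ∈ A, openConn o a) ∩ (openConn o b)ᶜ)
          + ∑ W ∈ (Finset.univ : Finset (Finset (Fin n))).filter (fun W => o ∈ W ∧ Disjoint W A),
              (prodBernoulli w).real {ω : BondConfig (Fin n) | openCluster ω o = (W : Set (Fin n))}
                * (prodBernoulli w).real (openConnIn ((W : Set (Fin n))ᶜ) (sel W) b)ᶜ
          ≤ (prodBernoulli w).real (openConn a b)ᶜ := by
  intro k
  induction k with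
  | zero =>
    intro w A o b hbA hoA hcard
    have hiso : ∀ z : Fin n, z ∉ A → z ≠ o → (w s(o, z) : ℝ) = 0 := by
      intro z hz hzo
      by_contra hne
      have hmem : z ∈ Finset.univ.filter (fun z : Fin n => z ∉ A ∧ z ≠ o ∧ (w s(o, z) : ℝ) ≠ 0) :=
        Finset.mem_filter.2 ⟨Finset.mem_univ _, hz, hzo, hne⟩
      rw [Finset.card_eq_zero.1 hcard] at hmem
      exact Finset.notMem_empty _ hmem
    obtain ⟨a, haA, hmin⟩ := Finset.exists_min_image A
      (fun x => (prodBernoulli w).real (openConn x b)) ⟨b, hbA⟩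
    refine ⟨a, haA, fun sel hsel => ?_⟩
    have h := stub_goodBase stub_lemma5AnyRelay n w A o b hbA hoA hiso
      (1 - (prodBernoulli w).real (openConn a b)) sel hsel (fun x hx => by linarith [hmin x hx])
    rwa [probReal_compl_eq_one_sub (Set.toFinite _).measurableSet]
  | succ k ih =>
    intro w A o b hbA hoA hcard
    obtain ⟨y, hy⟩ : (Finset.univ.filter
        (fun z : Fin n => z ∉ A ∧ z ≠ o ∧ (w s(o, z) : ℝ) ≠ 0)).Nonempty := by
      rw [← Finset.card_pos, hcard]
      exact Nat.succ_pos k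
    obtain ⟨-, hyA, hyo, -⟩ := Finset.mem_filter.1 hy
    -- the low pairs of `w[e ↦ 0]` are those of `w` minus `y`
    have hlow : Finset.univ.filter
        (fun z : Fin n => z ∉ A ∧ z ≠ o ∧ ((Function.update w s(o, y) 0) s(o, z) : ℝ) ≠ 0) =
        (Finset.univ.filter (fun z : Fin n => z ∉ A ∧ z ≠ o ∧ (w s(o, z) : ℝ) ≠ 0)).erase y := by
      ext z
      simp only [Finset.mem_filter, Finset.mem_univ, true_and, Finset.mem_erase]
      by_cases hzy : z = y
      · subst hzy
        simp
      · have hne : s(o, z) ≠ s(o, y) := fun h => hzy (Sym2.congr_right.1 h)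
        rw [Function.update_of_ne hne]
        tauto
    have hcard₀ : (Finset.univ.filter
        (fun z : Fin n => z ∉ A ∧ z ≠ o ∧ ((Function.update w s(o, y) 0) s(o, z) : ℝ) ≠ 0)).card = k := by
      rw [hlow, Finset.card_erase_of_mem hy, hcard]
      rfl
    obtain ⟨a', ha'A, hgood₀⟩ := ih (Function.update w s(o, y) 0) A o b hbA hoA hcard₀
    -- the `τ_{w₀}`-minimiser `a₀` is good for `w₀`
    obtain ⟨a₀, ha₀A, hmin⟩ := Finset.exists_min_image A
      (fun x => (prodBernoulli (Function.update w s(o, y) 0)).real (openConn x b)) ⟨b, hbA⟩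
    refine ⟨a₀, ha₀A, fun sel hsel => ?_⟩
    have h0 := hgood₀ sel hsel
    rw [probReal_compl_eq_one_sub (Set.toFinite _).measurableSet] at h0
    have h0' : (prodBernoulli (Function.update w s(o, y) 0)).real ((⋃ a ∈ A, openConn o a) ∩ (openConn o b)ᶜ)
          + ∑ W ∈ (Finset.univ : Finset (Finset (Fin n))).filter (fun W => o ∈ W ∧ Disjoint W A),
              (prodBernoulli (Function.update w s(o, y) 0)).real
                  {ω : BondConfig (Fin n) | openCluster ω o = (W : Set (Fin n))}
                * (prodBernoulli (Function.update w s(o, y) 0)).real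
                    (openConnIn ((W : Set (Fin n))ᶜ) (sel W) b)ᶜ
          ≤ (prodBernoulli (Function.update w s(o, y) 0)).real (openConn a₀ b)ᶜ := by
      rw [probReal_compl_eq_one_sub (Set.toFinite _).measurableSet]
      linarith [hmin a' ha'A]
    -- `hR4`: `a₀` is good for `w₁`
    have hw₁e : Function.update w s(o, y) 1 s(o, y) = 1 := Function.update_self _ _ _
    have hupd : Function.update (Function.update w s(o, y) 1) s(o, y) 0 = Function.update w s(o, y) 0 :=
      Function.update_idem _ _ _
    have h1 := hR4 n (Function.update w s(o, y) 1) A o y b a₀ hbA hoA hyA hyo ha₀A hw₁e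
      (fun x hx => by rw [hupd]; exact hmin x hx) sel hsel
    exact goodStepEI_interpolate w A o y b a₀ sel h0' h1

/-- **`stub_goodStep` from two-block designated goodness.**  The displayed hypothesis `hR4`
("R4", this session's reduction target) says: for a pair `e = s(o,y)` of weight `1` joining the
observer to a non-relay `y`, every `τ`-minimiser `a₀` of the graph WITH `e` DELETED is good for the
graph itself — equivalently, Kozma–Nitzan goodness (arXiv:2401.12397 §3.2) with the Question-9
relay (ibid. §5.5) for the two-block `{o, y}` / an observer that is a sure star of degree two.
Given `hR4`, the registered signature of `stub_goodStep` holds — with its induction hypothesis and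
its low-neighbour hypothesis unused (`goodStepEI_designated` inducts on the low pairs at `o`
instead, down to the landed base `stub_goodBase stub_lemma5AnyRelay`). -/
theorem stub_goodStepOfTwoBlock_k15 :
    (∀ (n : ℕ) (w : Sym2 (Fin n) → unitInterval) (A : Finset (Fin n)) (o y b a₀ : Fin n),
      b ∈ A → o ∉ A → y ∉ A → y ≠ o → a₀ ∈ A → w s(o, y) = 1 →
      (∀ a ∈ A, (prodBernoulli (Function.update w s(o, y) 0)).real (openConn a₀ b)
        ≤ (prodBernoulli (Function.update w s(o, y) 0)).real (openConn a b)) →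
      ∀ (sel : Finset (Fin n) → Fin n), (∀ W, sel W ∈ A) →
        (prodBernoulli w).real ((⋃ a ∈ A, openConn o a) ∩ (openConn o b)ᶜ)
          + ∑ W ∈ (Finset.univ : Finset (Finset (Fin n))).filter (fun W => o ∈ W ∧ Disjoint W A),
              (prodBernoulli w).real {ω : BondConfig (Fin n) | openCluster ω o = (W : Set (Fin n))}
                * (prodBernoulli w).real (openConnIn ((W : Set (Fin n))ᶜ) (sel W) b)ᶜ
          ≤ (prodBernoulli w).real (openConn a₀ b)ᶜ) →
    ∀ (n : ℕ) (w : Sym2 (Fin n) → unitInterval) (A : Finset (Fin n)) (o b : Fin n),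
      b ∈ A → o ∉ A →
      (∃ y : Fin n, y ∉ A ∧ y ≠ o ∧ (w s(o, y) : ℝ) ≠ 0) →
      (∀ w' : Sym2 (Fin n) → unitInterval,
        (Finset.univ.filter (fun v : Fin n => ∃ u : Fin n, 0 < (w' s(u, v) : ℝ))).card
          < (Finset.univ.filter (fun v : Fin n => ∃ u : Fin n, 0 < (w s(u, v) : ℝ))).card →
        ∀ (A' : Finset (Fin n)) (o' b' : Fin n), b' ∈ A' → o' ∉ A' →
        ∀ (t : ℝ) (sel : Finset (Fin n) → Fin n), (∀ W, sel W ∈ A') →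
          (∀ a ∈ A', 1 - t ≤ (prodBernoulli w').real (openConn a b')) →
          (prodBernoulli w').real ((⋃ a ∈ A', openConn o' a) ∩ (openConn o' b')ᶜ)
            + ∑ W ∈ (Finset.univ : Finset (Finset (Fin n))).filter (fun W => o' ∈ W ∧ Disjoint W A'),
                (prodBernoulli w').real {ω : BondConfig (Fin n) | openCluster ω o' = (W : Set (Fin n))}
                  * (prodBernoulli w').real (openConnIn ((W : Set (Fin n))ᶜ) (sel W) b')ᶜ
            ≤ t) →
      ∀ (t : ℝ) (sel : Finset (Fin n) → Fin n), (∀ W, sel W ∈ A) →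
        (∀ a ∈ A, 1 - t ≤ (prodBernoulli w).real (openConn a b)) →
        (prodBernoulli w).real ((⋃ a ∈ A, openConn o a) ∩ (openConn o b)ᶜ)
          + ∑ W ∈ (Finset.univ : Finset (Finset (Fin n))).filter (fun W => o ∈ W ∧ Disjoint W A),
              (prodBernoulli w).real {ω : BondConfig (Fin n) | openCluster ω o = (W : Set (Fin n))}
                * (prodBernoulli w).real (openConnIn ((W : Set (Fin n))ᶜ) (sel W) b)ᶜ
          ≤ t := by
  intro hR4 n w A o b hbA hoA _ _ t sel hsel hrel
  obtain ⟨a, haA, hgood⟩ := goodStepEI_designated hR4 _ w A o b hbA hoA rfl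
  have h := hgood sel hsel
  rw [probReal_compl_eq_one_sub (Set.toFinite _).measurableSet] at h
  linarith [hrel a haA]

end

end Summit.CriticalPhenomena.PercolationContinuityZ3.Theorems
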